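import Mathlib.Analysis.Calculus.ParametricIntervalIntegral
import Mathlib.MeasureTheory.Integral.IntervalIntegral.FundThmCalculus
import Mathlib.Analysis.Calculus.ContDiff.RCLike
import Mathlib.Analysis.Normed.Module.FiniteDimension
import Mathlib.Analysis.InnerProductSpace.PiL2
import HarnessLib

/-!
# The Poincaré lemma for `1`-forms on a ball: the radial homotopy operator

For a covector field `A : E → E →L[ℝ] ℝ` (a `1`-form `∑ Aᵢ dxⁱ`) on a finite-dimensional real
normed space, *closedness* `dA = 0` is the symmetry of the derivative, `DA(z)(v)(w) = DA(z)(w)(v)`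
(`∂ᵥ A_w = ∂_w A_v`). The **Poincaré lemma** (Spivak, *Calculus on Manifolds* (1965), Thm. 4-11:
"if `A ⊂ ℝⁿ` is an open set star-shaped with respect to `0`, then every closed form on `A` is
exact", proved with the radial homotopy operator `Iω`) says that on a ball such a field is a
differential: with

  `u(y) = ∫₀¹ A(z₀ + t (y - z₀)) (y - z₀) dt`

one has `Du(z) = A(z)` for all `z ∈ B(z₀, r)`. This file proves it in Mathlib's Fréchet calculus:

* `hasFDerivAt_radialIntegral` — `Du(z) = A(z)` for `A` of class `C¹` and closed on `B(z₀, r)`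
  (differentiation under the integral sign, `intervalIntegral.hasFDerivAt_integral_of_dominated_of_fderiv_le`,
  and the fundamental theorem of calculus for `t ↦ t A(z₀ + t(z - z₀)) w`, whose derivative is the
  integrand of `Du(z) w` by the symmetry of `DA`);
* `contDiffOn_radialIntegral` — for `A` of class `C^∞` the potential is `C^∞`;
* `exists_contDiffOn_hasFDerivAt_of_fderiv_symm` — existence form.

(Mathlib has no Poincaré lemma at the time of writing.) Used for the local exactness of closed
`1`-forms on manifolds (Bochner formula for harmonic `1`-forms,
`Literature/Geometry/Riemannian/`). Everything is proved; no definitions, no named facts.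

## References

* M. Spivak, *Calculus on Manifolds*, Benjamin 1965, Thm. 4-11 (Poincaré Lemma) and the
  operator `I` before it (p. 94). [`Spivak1965`]
* J. M. Lee, *Introduction to Smooth Manifolds*, 2nd ed., Springer 2013, Thm. 11.49 (Poincaré
  lemma for covector fields) and Thm. 17.14. [`LeeSmoothManifolds2013`]
-/

noncomputable section

open Set Metric MeasureTheory intervalIntegral Filter
open scoped Topology Interval

namespace Literature.Analysis.Calculus

variable {E : Type*} [NormedAddCommGroup E] [NormedSpace ℝ E]

/-- Points of the ray from `z₀` to `y ∈ B(z, ρ)`, `ρ = r' - ‖z - z₀‖`, at times `t ∈ [0, 1]` stay in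
`B(z₀, r')`. [folklore] -/
theorem add_smul_sub_mem_ball {z₀ z y : E} {r' t : ℝ} (hy : y ∈ ball z (r' - ‖z - z₀‖))
    (ht : t ∈ Icc (0 : ℝ) 1) : z₀ + t • (y - z₀) ∈ ball z₀ r' := by
  rw [mem_ball_iff_norm] at hy ⊢
  have hy' : ‖y - z₀‖ < r' := by
    calc ‖y - z₀‖ = ‖(y - z) + (z - z₀)‖ := by congr 1; abel
      _ ≤ ‖y - z‖ + ‖z - z₀‖ := norm_add_le _ _
      _ < r' := by linarith
  calc ‖z₀ + t • (y - z₀) - z₀‖ = ‖t • (y - z₀)‖ := by congr 1; abel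
    _ = |t| * ‖y - z₀‖ := by rw [norm_smul, Real.norm_eq_abs]
    _ ≤ 1 * ‖y - z₀‖ := by
        gcongr
        exact abs_le.2 ⟨by linarith [ht.1], ht.2⟩
    _ < r' := by linarith

variable [FiniteDimensional ℝ E]

/-- **The Poincaré lemma for `1`-forms on a ball (radial homotopy formula).** Let
`A : E → E →L[ℝ] ℝ` be a covector field of class `C¹` on the ball `B(z₀, r)` of a
finite-dimensional real normed space which is *closed* there — its derivative is symmetric,
`DA(z)(v)(w) = DA(z)(w)(v)`. Then the radial integral `u(y) = ∫₀¹ A(z₀ + t(y - z₀)) (y - z₀) dt`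
satisfies `du(z) = A(z)` at every `z ∈ B(z₀, r)`. (Differentiate under the integral sign; by the
symmetry of `DA` the integrand of `du(z) w` is `d/dt [t A(z₀ + t(z - z₀)) w]`.)
Spivak, *Calculus on Manifolds* (1965), Thm. 4-11 (Poincaré Lemma, star-shaped domains);
Lee, *Introduction to Smooth Manifolds*, 2nd ed., Thm. 11.49. [cite: Spivak1965, Thm. 4-11] -/
theorem hasFDerivAt_radialIntegral {A : E → E →L[ℝ] ℝ} {z₀ : E} {r : ℝ}
    (hA : ContDiffOn ℝ 1 A (ball z₀ r))
    (hsymm : ∀ z ∈ ball z₀ r, ∀ v w : E, fderiv ℝ A z v w = fderiv ℝ A z w v)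
    {z : E} (hz : z ∈ ball z₀ r) :
    HasFDerivAt (fun y ↦ ∫ t in (0 : ℝ)..1, A (z₀ + t • (y - z₀)) (y - z₀)) (A z) z := by
  -- radii: `‖z - z₀‖ < r' < r`, `ρ = r' - ‖z - z₀‖ > 0`
  have hzr : ‖z - z₀‖ < r := by rwa [mem_ball_iff_norm] at hz
  set r' := (‖z - z₀‖ + r) / 2 with hr'
  have hr'r : r' < r := by rw [hr']; linarith
  have hzr' : ‖z - z₀‖ < r' := by rw [hr']; linarith
  set ρ := r' - ‖z - z₀‖ with hρ
  have hρ0 : 0 < ρ := by rw [hρ]; linarith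
  have hball : ball z₀ r' ⊆ ball z₀ r := ball_subset_ball hr'r.le
  have hKsub : closedBall z₀ r' ⊆ ball z₀ r := closedBall_subset_ball hr'r
  have hray : ∀ y ∈ ball z ρ, ∀ t ∈ Icc (0 : ℝ) 1, z₀ + t • (y - z₀) ∈ ball z₀ r' :=
    fun y hy t ht ↦ add_smul_sub_mem_ball hy ht
  have hzρ : z ∈ ball z ρ := mem_ball_self hρ0
  -- bounds for `A` and `DA` on the compact ball `closedBall z₀ r'`
  have hAc : ContinuousOn A (ball z₀ r) := hA.continuousOn
  have hDAc : ContinuousOn (fderiv ℝ A) (ball z₀ r) :=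
    hA.continuousOn_fderiv_of_isOpen isOpen_ball le_rfl
  obtain ⟨C₀, hC₀⟩ := (isCompact_closedBall z₀ r').exists_bound_of_continuousOn (hAc.mono hKsub)
  obtain ⟨C₁, hC₁⟩ := (isCompact_closedBall z₀ r').exists_bound_of_continuousOn
    (f := fun p ↦ (fderiv ℝ A p : E →L[ℝ] E →L[ℝ] ℝ)) (hDAc.mono hKsub)
  -- `A` is differentiable at the points of the ball
  have hAd : ∀ p ∈ ball z₀ r, HasFDerivAt A (fderiv ℝ A p) p := fun p hp ↦
    (((hA.differentiableOn one_ne_zero) p hp).differentiableAt (isOpen_ball.mem_nhds hp)).hasFDerivAt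
  -- the integrand `F` and its derivative `F'` in `y`
  set F : E → ℝ → ℝ := fun y t ↦ A (z₀ + t • (y - z₀)) (y - z₀) with hF
  set F' : E → ℝ → E →L[ℝ] ℝ := fun y t ↦
    t • (fderiv ℝ A (z₀ + t • (y - z₀))).flip (y - z₀) + A (z₀ + t • (y - z₀)) with hF'
  -- (1) pointwise differentiability in `y`
  have hdiff : ∀ t ∈ Icc (0 : ℝ) 1, ∀ y ∈ ball z ρ, HasFDerivAt (fun y ↦ F y t) (F' y t) y := by
    intro t ht y hy
    have hγ : HasFDerivAt (fun y : E ↦ z₀ + t • (y - z₀)) (t • ContinuousLinearMap.id ℝ E) y := by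
      have h1 : HasFDerivAt (fun y : E ↦ y - z₀) (ContinuousLinearMap.id ℝ E) y :=
        (hasFDerivAt_id y).sub_const z₀
      exact (h1.const_smul t).const_add z₀
    have hAγ : HasFDerivAt (fun y : E ↦ A (z₀ + t • (y - z₀)))
        ((fderiv ℝ A (z₀ + t • (y - z₀))).comp (t • ContinuousLinearMap.id ℝ E)) y :=
      (hAd _ (hball (hray y hy t ht))).comp y hγ
    have hu : HasFDerivAt (fun y : E ↦ y - z₀) (ContinuousLinearMap.id ℝ E) y :=
      (hasFDerivAt_id y).sub_const z₀
    have h := hAγ.clm_apply hu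
    refine h.congr_fderiv ?_
    ext w
    simp only [hF', add_apply, smul_apply,
      ContinuousLinearMap.flip_apply, ContinuousLinearMap.comp_apply,
      ContinuousLinearMap.id_apply, map_smul, smul_eq_mul]
    ring
  -- (2) continuity in `t` on `[0, 1]` of `F y` (`y` near `z`) and of `F' z`
  have hγc : ∀ y, Continuous (fun t : ℝ ↦ z₀ + t • (y - z₀)) := fun y ↦ by fun_prop
  have hγmaps : ∀ y ∈ ball z ρ, MapsTo (fun t : ℝ ↦ z₀ + t • (y - z₀)) (Icc 0 1) (ball z₀ r) :=
    fun y hy t ht ↦ hball (hray y hy t ht)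
  have hFc : ∀ y ∈ ball z ρ, ContinuousOn (F y) (Icc 0 1) := by
    intro y hy
    have h1 : ContinuousOn (fun t : ℝ ↦ A (z₀ + t • (y - z₀))) (Icc 0 1) :=
      hAc.comp (hγc y).continuousOn (hγmaps y hy)
    exact h1.clm_apply continuousOn_const
  have hF'c : ContinuousOn (F' z) (Icc 0 1) := by
    have h1 : ContinuousOn (fun t : ℝ ↦ A (z₀ + t • (z - z₀))) (Icc 0 1) :=
      hAc.comp (hγc z).continuousOn (hγmaps z hzρ)
    have h2 : ContinuousOn (fun t : ℝ ↦ fderiv ℝ A (z₀ + t • (z - z₀))) (Icc 0 1) :=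
      hDAc.comp (hγc z).continuousOn (hγmaps z hzρ)
    have h3 : ContinuousOn (fun t : ℝ ↦ (fderiv ℝ A (z₀ + t • (z - z₀))).flip (z - z₀))
        (Icc 0 1) :=
      ((ContinuousLinearMap.flipₗᵢ ℝ E E ℝ).continuous.comp_continuousOn h2).clm_apply
        continuousOn_const
    exact (continuousOn_id.smul h3).add h1
  have hIoc : Ι (0 : ℝ) 1 ⊆ Icc 0 1 := by
    rw [uIoc_of_le zero_le_one]; exact Ioc_subset_Icc_self
  -- (3) differentiate under the integral sign
  have hmain : HasFDerivAt (fun y ↦ ∫ t in (0 : ℝ)..1, F y t) (∫ t in (0 : ℝ)..1, F' z t) z := by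
    refine hasFDerivAt_integral_of_dominated_of_fderiv_le (μ := volume)
      (bound := fun _ ↦ (max C₁ 0) * r' + C₀) (isOpen_ball.mem_nhds hzρ) ?_ ?_ ?_ ?_ ?_ ?_
    · filter_upwards [isOpen_ball.mem_nhds hzρ] with y hy
      exact ((hFc y hy).mono hIoc).aestronglyMeasurable measurableSet_uIoc
    · exact ((hFc z hzρ).mono (by rw [uIcc_of_le zero_le_one])).intervalIntegrable
    · exact (hF'c.mono hIoc).aestronglyMeasurable measurableSet_uIoc
    · refine ae_of_all _ fun t ht y hy ↦ ?_
      have ht' : t ∈ Icc (0 : ℝ) 1 := hIoc ht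
      have hγK : z₀ + t • (y - z₀) ∈ closedBall z₀ r' := ball_subset_closedBall (hray y hy t ht')
      have hyr' : ‖y - z₀‖ ≤ r' := by
        have := hray y hy 1 ⟨zero_le_one, le_rfl⟩
        rw [one_smul, add_sub_cancel, mem_ball_iff_norm] at this
        exact this.le
      calc ‖F' y t‖ ≤ ‖t • (fderiv ℝ A (z₀ + t • (y - z₀))).flip (y - z₀)‖ +
            ‖A (z₀ + t • (y - z₀))‖ := norm_add_le _ _
        _ ≤ 1 * ((max C₁ 0) * r') + C₀ := by
          gcongr
          · rw [norm_smul, Real.norm_eq_abs]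
            gcongr
            · exact abs_le.2 ⟨by linarith [ht'.1], ht'.2⟩
            · calc ‖(fderiv ℝ A (z₀ + t • (y - z₀))).flip (y - z₀)‖
                  ≤ ‖(fderiv ℝ A (z₀ + t • (y - z₀))).flip‖ * ‖y - z₀‖ :=
                    ContinuousLinearMap.le_opNorm _ _
                _ ≤ (max C₁ 0) * r' := by
                    rw [ContinuousLinearMap.opNorm_flip]
                    exact mul_le_mul ((hC₁ _ hγK).trans (le_max_left _ _)) hyr'
                      (norm_nonneg _) (le_max_right _ _)
          · exact hC₀ _ hγK
        _ = (max C₁ 0) * r' + C₀ := by ring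
    · exact intervalIntegrable_const
    · exact ae_of_all _ fun t ht y hy ↦ hdiff t (hIoc ht) y hy
  -- (4) the derivative is `A z`: `∫₀¹ F'(z, t) w dt = ∫₀¹ d/dt (t A(z₀ + t(z - z₀)) w) dt = A(z) w`
  have hint : IntervalIntegrable (F' z) volume 0 1 :=
    (hF'c.mono (by rw [uIcc_of_le zero_le_one])).intervalIntegrable
  have key : ∫ t in (0 : ℝ)..1, F' z t = A z := by
    apply ContinuousLinearMap.ext
    intro w
    rw [ContinuousLinearMap.intervalIntegral_apply hint w]
    have hφ : ∀ t ∈ uIcc (0 : ℝ) 1,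
        HasDerivAt (fun t : ℝ ↦ t * A (z₀ + t • (z - z₀)) w) (F' z t w) t := by
      intro t ht
      rw [uIcc_of_le zero_le_one] at ht
      have hmem : z₀ + t • (z - z₀) ∈ ball z₀ r := hball (hray z hzρ t ht)
      have hγ' : HasDerivAt (fun t : ℝ ↦ z₀ + t • (z - z₀)) (z - z₀) t := by
        simpa using ((hasDerivAt_id t).smul_const (z - z₀)).const_add z₀
      have hAγ : HasDerivAt (fun t : ℝ ↦ A (z₀ + t • (z - z₀)))
          (fderiv ℝ A (z₀ + t • (z - z₀)) (z - z₀)) t :=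
        (hAd _ hmem).comp_hasDerivAt t hγ'
      have hAw : HasDerivAt (fun t : ℝ ↦ A (z₀ + t • (z - z₀)) w)
          (fderiv ℝ A (z₀ + t • (z - z₀)) (z - z₀) w) t := by
        simpa using hAγ.clm_apply (hasDerivAt_const t w)
      have h := (hasDerivAt_id t).mul hAw
      refine h.congr_deriv ?_
      simp only [hF', add_apply, smul_apply,
        ContinuousLinearMap.flip_apply, smul_eq_mul, id, hsymm _ hmem (z - z₀) w]
      ring
    have hint' : IntervalIntegrable (fun t ↦ F' z t w) volume 0 1 :=
      ((hF'c.clm_apply continuousOn_const).mono (by rw [uIcc_of_le zero_le_one])).intervalIntegrable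
    rw [integral_eq_sub_of_hasDerivAt hφ hint']
    simp
  rw [key] at hmain
  exact hmain

open scoped ContDiff in
/-- **Smooth potentials.** If the closed covector field `A` is `C^∞` on the ball, its radial
integral `u` is `C^∞` there, with `Du = A` (a function with `C^∞` derivative is `C^∞`,
`contDiffOn_infty_iff_fderiv_of_isOpen`). Spivak 1965, Thm. 4-11. [cite: Spivak1965, Thm. 4-11] -/
theorem contDiffOn_radialIntegral {A : E → E →L[ℝ] ℝ} {z₀ : E} {r : ℝ}
    (hA : ContDiffOn ℝ ∞ A (ball z₀ r))
    (hsymm : ∀ z ∈ ball z₀ r, ∀ v w : E, fderiv ℝ A z v w = fderiv ℝ A z w v) :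
    ContDiffOn ℝ ∞ (fun y ↦ ∫ t in (0 : ℝ)..1, A (z₀ + t • (y - z₀)) (y - z₀)) (ball z₀ r) := by
  have hA1 : ContDiffOn ℝ 1 A (ball z₀ r) := hA.of_le (by exact_mod_cast le_top)
  have hd := fun z (hz : z ∈ ball z₀ r) ↦ hasFDerivAt_radialIntegral hA1 hsymm hz
  rw [contDiffOn_infty_iff_fderiv_of_isOpen isOpen_ball]
  exact ⟨fun z hz ↦ (hd z hz).differentiableAt.differentiableWithinAt,
    hA.congr fun z hz ↦ (hd z hz).fderiv⟩

open scoped ContDiff in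
/-- **The Poincaré lemma for `1`-forms, existence form**: a `C^∞` covector field with symmetric
derivative on a ball of a finite-dimensional real normed space is the differential of a `C^∞`
function on that ball. Spivak 1965, Thm. 4-11; Lee, *Introduction to Smooth Manifolds*, 2nd ed.,
Thm. 11.49. [cite: Spivak1965, Thm. 4-11] -/
theorem exists_contDiffOn_hasFDerivAt_of_fderiv_symm {A : E → E →L[ℝ] ℝ} {z₀ : E} {r : ℝ}
    (hA : ContDiffOn ℝ ∞ A (ball z₀ r))
    (hsymm : ∀ z ∈ ball z₀ r, ∀ v w : E, fderiv ℝ A z v w = fderiv ℝ A z w v) :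
    ∃ u : E → ℝ, ContDiffOn ℝ ∞ u (ball z₀ r) ∧ ∀ z ∈ ball z₀ r, HasFDerivAt u (A z) z :=
  ⟨_, contDiffOn_radialIntegral hA hsymm, fun _ hz ↦
    hasFDerivAt_radialIntegral (hA.of_le (by exact_mod_cast le_top)) hsymm hz⟩

end Literature.Analysis.Calculus

end
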